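import Summits.CriticalPhenomena.PercolationContinuityZ3.Theorems.PercNearOneGluingNoHeavyQuantCatHullNestedGate
import Summits.CriticalPhenomena.PercolationContinuityZ3.Theorems.PercNearOneGluingNoHeavyQuantLightPairBlobForest
import HarnessLib

/-!
# QUANT lane R8, T-DEC: THE LARGE-GATE PAIR LEMMA — the third regime `T ≥ max(m_P, m_Q)` of the pair lemma (P): the join
# `gate_s P ∗ gate_t Q` is the three-column member `ω₁·(gate_γ P ∗ Q) + ω₂·(gate_γ′ Q ∗ P) + ω₀·gate_{T/(m_P+m_Q)}(P ∗ Q)` with BOTH factors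
# nested (`γ = (T−m_Q)/m_P`, `γ′ = (T−m_P)/m_Q`); the glued pair `(R¹[q](R^c[s]))²` is a member at EVERY floor `y ≤ (2q−1)s`, all `q > 1/2`

builds on p205010 (kernel theorem, internal audit signed; external expert review pending)

Support file (`--supports stmt-CriticalPhenomena-4575`), QUANT lane census seat prim-quant-census-2 (gen 77), rung R8 of
`run/shared/lean/prim/quant/LADDER.md`.  Theorems only; standard axioms, no sorries.  Completes the TRICHOTOMY begun in `…QuantCatHullSmallGates`
(✓ p490773, `T ≤ min`) and `…QuantCatHullNestedGate` (✓ p493169, `m_Q ≤ T ≤ m_P`): every target `T = s·m_P + t·m_Q` lies in one of the three regimes.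

WHAT.  With `D = m_P + m_Q − T = (1−s)m_P + (1−t)m_Q > 0`:
  `gate_s P ∗ gate_t Q = ω₁·(gate_γ P ∗ Q) + ω₂·(gate_γ′ Q ∗ P) + ω₀·gate_{T/(m_P+m_Q)}(P ∗ Q)`,
  `γ = (T − m_Q)/m_P`, `γ′ = (T − m_P)/m_Q`, `ω₁ = (1−s)t·m_P/D`, `ω₂ = s(1−t)·m_Q/D`, `ω₀ = (1−s)(1−t)(m_P+m_Q)/D`
(`lconv_gate_gate_eq_binested`; all three weights are nonnegative AUTOMATICALLY and sum to 1; `γ, γ′ ∈ [0,1]` iff `max(m_P, m_Q) ≤ T`).  PRICE: both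
factors sit under the nested gates, so `P` needs floor slack `y/γ` and `Q` needs `y/γ′`: for a floor-tight law the certificate lives at a LOWER floor.
* **`InGatedCatHull.lconv_gate_gate_of_large`** (hull-relative), **`catPairBlob_inGatedCatHull_of_large`** (both factors blob forests; the two nested
  columns are caterpillars by `catBuilt_lconv_blobLaw`); `lpSib_pair_inGatedCatHull_of_large` (unequal glued siblings);
* **`lpT_inGatedCatHull_largeGate : 1/2 < q < 1 → 0 < s < 1 → 0 < y ≤ (2q−1)s → InGatedCatHull y (2q(1+cs)) (2c+2) (lpT c q s)`** — the glued pair for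
  EVERY root gate above `1/2` at every floor up to `(2q−1)s`, i.e. `(1−q)s` below its natural floor `qs` (exactly FREEHULL-G75 §4c's "floor deficit of
  the residual caterpillar `ρ ∗ gate_{2q−1}ρ`", now a theorem with the deficit paid by lowering the floor).  With p490773 (`q ≤ 1/2`, natural floor) the
  family is a member at an EXPLICIT floor for ALL parameters; heavy pairs included (e.g. `q = .95, s = .6`: natural floor `.57`, member at every `y ≤ .54`
  — cf. the census: `(R¹[.95](R³[11/19]))²` OUT at its floor `.55`, IN at `.54`).
WHY IT MATTERS (census-2 g77 memo CENSUS-PAIRMAP-G77 §4): the census finds light glued pairs (`q ∈ [.55,.7]`, `qs = .49`, `c ∈ {3,4}`) OUT of the free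
gated-caterpillar hull AT their natural floor and IN just below it; this file is the structural counterpart — membership below the natural floor is
unconditional, the question mark is only the strip `((2q−1)s, qs]`.
HONEST STATUS.  Regions of (P) only; `TreeBuiltCatHullLight`, `CatPairLight` (under adverse census at the corner), `SiblingStep`, `FarTreeRow` remain
OPEN; RATE class log\* / honest sentence of `run/shared/lean/prim/quant/README.md` unchanged.  [this work].  Nothing here is cited as a published result.
The gluing rows served [cite: KozmaNitzan2024, Conjecture 3 (p. 15)]; product measure [cite: Grimmett1999, §1.3 p. 10].
-/

noncomputable section

open scoped BigOperators

namespace Summit.CriticalPhenomena.PercolationContinuityZ3.Theorems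
namespace Quant
namespace LawDec

open Finset

/-! ### The doubly nested identity (pure algebra) -/

/-- **THE DOUBLY NESTED IDENTITY.**  With `T = s·m₁ + t·m₂`, `D = m₁ + m₂ − T` (`m₁, m₂, m₁+m₂, D ≠ 0`):
`gate_s P ∗ gate_t Q = ((1−s)t·m₁/D)·(gate_{(T−m₂)/m₁} P ∗ Q) + (s(1−t)·m₂/D)·(gate_{(T−m₁)/m₂} Q ∗ P) + ((1−s)(1−t)(m₁+m₂)/D)·gate_{T/(m₁+m₂)}(P ∗ Q)`
pointwise. [this work] -/
theorem lconv_gate_gate_eq_binested (N₁ N₂ : ℕ) (P Q : ℕ → ℝ) (s t m₁ m₂ : ℝ) (hPM : ∀ h, N₁ < h → P h = 0)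
    (hQM : ∀ h, N₂ < h → Q h = 0) (hm₁ : m₁ ≠ 0) (hm₂ : m₂ ≠ 0) (hm : m₁ + m₂ ≠ 0) (hD : m₁ + m₂ - (s * m₁ + t * m₂) ≠ 0) (h : ℕ) :
    lconv N₁ N₂ (gate P s) (gate Q t) h =
      ((1 - s) * t * m₁ / (m₁ + m₂ - (s * m₁ + t * m₂))) * lconv N₁ N₂ (gate P ((s * m₁ + t * m₂ - m₂) / m₁)) Q h +
        (s * (1 - t) * m₂ / (m₁ + m₂ - (s * m₁ + t * m₂))) * lconv N₂ N₁ (gate Q ((s * m₁ + t * m₂ - m₁) / m₂)) P h +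
        ((1 - s) * (1 - t) * (m₁ + m₂) / (m₁ + m₂ - (s * m₁ + t * m₂))) *
          gate (lconv N₁ N₂ P Q) ((s * m₁ + t * m₂) / (m₁ + m₂)) h := by
  rw [lconv_gate_gate_expand N₁ N₂ P Q s t hPM hQM h, lconv_gate_left N₁ N₂ P Q _ hQM h, lconv_gate_left N₂ N₁ Q P _ hPM h,
    show lconv N₂ N₁ Q P = lconv N₁ N₂ P Q from (lconv_comm N₁ N₂ P Q).symm, gate_apply]
  field_simp
  ring

/-! ### The large-gate pair lemma, hull-relative form -/

/-- **THE LARGE-GATE PAIR LEMMA (hull-relative).**  Laws `P`, `Q` on `{0..N₁}`, `{0..N₂}` with means `0 < m₁, m₂`, outer gates `0 ≤ s ≤ 1`,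
`0 ≤ t < 1` with `m₁ ≤ T := s·m₁ + t·m₂` (the LARGE regime `max(m₁, m₂) ≤ T` is where both nested gates below lie in `[0,1]`); if the two nested columns `gate_γ P ∗ Q` (`γ = (T−m₂)/m₁`) and `gate_γ′ Q ∗ P`
(`γ′ = (T−m₁)/m₂`) are members of `FH(y₁, T)` resp. `FH(y₂, T)` and `P ∗ Q ∈ FH(y₃, m₁+m₂)`, then `gate_s P ∗ gate_t Q ∈ FH(y, T, N₁+N₂)` at every
floor `0 < y ≤ y₁, y₂` with `y(m₁+m₂) ≤ y₃·T`. [this work] -/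
theorem InGatedCatHull.lconv_gate_gate_of_large {y y₁ y₂ y₃ m₁ m₂ s t : ℝ} {N₁ N₂ : ℕ} {P Q : ℕ → ℝ}
    (hN₁ : InGatedCatHull y₁ (s * m₁ + t * m₂) (N₁ + N₂) (lconv N₁ N₂ (gate P ((s * m₁ + t * m₂ - m₂) / m₁)) Q))
    (hN₂ : InGatedCatHull y₂ (s * m₁ + t * m₂) (N₁ + N₂) (lconv N₂ N₁ (gate Q ((s * m₁ + t * m₂ - m₁) / m₂)) P))
    (hPQ : InGatedCatHull y₃ (m₁ + m₂) (N₁ + N₂) (lconv N₁ N₂ P Q))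
    (hPM : ∀ h, N₁ < h → P h = 0) (hQM : ∀ h, N₂ < h → Q h = 0)
    (hy0 : 0 < y) (hy₃ : 0 ≤ y₃) (hm₁ : 0 < m₁) (hm₂ : 0 < m₂)
    (hs0 : 0 ≤ s) (hs1 : s ≤ 1) (ht0 : 0 ≤ t) (ht1 : t < 1)
    (hT₁ : m₁ ≤ s * m₁ + t * m₂)
    (hf₁ : y ≤ y₁) (hf₂ : y ≤ y₂) (hf₃ : y * (m₁ + m₂) ≤ y₃ * (s * m₁ + t * m₂)) :
    InGatedCatHull y (s * m₁ + t * m₂) (N₁ + N₂) (lconv N₁ N₂ (gate P s) (gate Q t)) := by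
  set T := s * m₁ + t * m₂ with hTdef
  have hT0 : 0 < T := lt_of_lt_of_le hm₁ hT₁
  have hm : 0 < m₁ + m₂ := by linarith
  have hD : 0 < m₁ + m₂ - T := by nlinarith
  have hT₃ : T ≤ m₁ + m₂ := by linarith
  have hA : InGatedCatHull y T (N₁ + N₂) (lconv N₁ N₂ (gate P ((T - m₂) / m₁)) Q) := hN₁.mono hy0 hf₁
  have hB : InGatedCatHull y T (N₁ + N₂) (lconv N₂ N₁ (gate Q ((T - m₁) / m₂)) P) := hN₂.mono hy0 hf₂
  have hC : InGatedCatHull y T (N₁ + N₂) (gate (lconv N₁ N₂ P Q) (T / (m₁ + m₂))) := by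
    have g := inGatedCatHull_gate hPQ hy₃ (T / (m₁ + m₂)) (div_pos hT0 hm) ((div_le_one hm).2 hT₃)
    rw [div_mul_cancel₀ T hm.ne'] at g
    have hfl : y ≤ T / (m₁ + m₂) * y₃ := by
      rw [div_mul_eq_mul_div, le_div_iff₀ hm]; nlinarith [hf₃]
    exact g.mono hy0 hfl
  refine InGatedCatHull.mix3 ((1 - s) * t * m₁ / (m₁ + m₂ - T)) (s * (1 - t) * m₂ / (m₁ + m₂ - T))
    ((1 - s) * (1 - t) * (m₁ + m₂) / (m₁ + m₂ - T))
    (div_nonneg (mul_nonneg (mul_nonneg (by linarith) ht0) hm₁.le) hD.le)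
    (div_nonneg (mul_nonneg (mul_nonneg hs0 (by linarith)) hm₂.le) hD.le)
    (div_nonneg (mul_nonneg (mul_nonneg (by linarith) (by linarith)) hm.le) hD.le) ?_ hA hB hC fun h => ?_
  · field_simp
    rw [hTdef]
    ring
  · exact lconv_gate_gate_eq_binested N₁ N₂ P Q s t m₁ m₂ hPM hQM hm₁.ne' hm₂.ne' hm.ne' hD.ne' h

/-! ### Both factors blob forests -/

/-- **(P) IN THE LARGE REGIME FOR TWO GATED BLOB FORESTS.**  Blob forests `P = blobLaw l₁` (gates in `[x₁, 1]`, mean `m₁ > 0`) and `Q = blobLaw l₂`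
(gates in `[x₂, 1]`, mean `m₂ > 0`), outer gates `0 < s ≤ 1`, `0 < t < 1` with `max(m₁, m₂) ≤ T := s·m₁ + t·m₂`, and a floor `0 < y < 1` with the
SLACKS `y·m₁ ≤ (T − m₂)·x₁`, `y·m₂ ≤ (T − m₁)·x₂` (they force `T > m₂`, `T > m₁`) and `y·(m₁+m₂) ≤ x₁·T`, `y·(m₁+m₂) ≤ x₂·T` (and `y ≤ x₁, x₂`): the join
`gate_s(blobLaw l₁) ∗ gate_t(blobLaw l₂)` lies in `FH(y, T, blobTop l₁ + blobTop l₂)`. [this work] -/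
theorem catPairBlob_inGatedCatHull_of_large {y s t x₁ x₂ : ℝ} (l₁ l₂ : List (ℕ × ℝ))
    (hy0 : 0 < y) (hy1 : y < 1) (hs0 : 0 < s) (hs1 : s ≤ 1) (ht0 : 0 < t) (ht1 : t < 1)
    (hx₁ : y ≤ x₁) (hx₁1 : x₁ < 1) (hx₂ : y ≤ x₂) (hx₂1 : x₂ < 1)
    (hl₁ : ∀ p ∈ l₁, x₁ ≤ p.2 ∧ p.2 ≤ 1) (hl₂ : ∀ p ∈ l₂, x₂ ≤ p.2 ∧ p.2 ≤ 1)
    (hm₁ : 0 < blobMean l₁) (hm₂ : 0 < blobMean l₂)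
    (hT₁ : blobMean l₁ ≤ s * blobMean l₁ + t * blobMean l₂)
    (hsl₁ : y * blobMean l₁ ≤ (s * blobMean l₁ + t * blobMean l₂ - blobMean l₂) * x₁)
    (hsl₂ : y * blobMean l₂ ≤ (s * blobMean l₁ + t * blobMean l₂ - blobMean l₁) * x₂)
    (hf₁ : y * (blobMean l₁ + blobMean l₂) ≤ x₁ * (s * blobMean l₁ + t * blobMean l₂))
    (hf₂ : y * (blobMean l₁ + blobMean l₂) ≤ x₂ * (s * blobMean l₁ + t * blobMean l₂)) :
    InGatedCatHull y (s * blobMean l₁ + t * blobMean l₂) (blobTop l₁ + blobTop l₂)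
      (lconv (blobTop l₁) (blobTop l₂) (gate (blobLaw l₁) s) (gate (blobLaw l₂) t)) := by
  set m₁ := blobMean l₁ with hm₁def
  set m₂ := blobMean l₂ with hm₂def
  set T := s * m₁ + t * m₂ with hTdef
  have hT0 : 0 < T := lt_of_lt_of_le hm₁ hT₁
  have hx₁0 : 0 < x₁ := lt_of_lt_of_le hy0 hx₁
  have hx₂0 : 0 < x₂ := lt_of_lt_of_le hy0 hx₂
  have hly₁ : ∀ p ∈ l₁, y ≤ p.2 ∧ p.2 ≤ 1 := fun p hp => ⟨hx₁.trans (hl₁ p hp).1, (hl₁ p hp).2⟩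
  have hly₂ : ∀ p ∈ l₂, y ≤ p.2 ∧ p.2 ≤ 1 := fun p hp => ⟨hx₂.trans (hl₂ p hp).1, (hl₂ p hp).2⟩
  have cP : CatBuilt x₁ (blobTop l₁) (blobLaw l₁) := catBuilt_blobLaw x₁ hx₁0 hx₁1 l₁ hl₁
  have cQ : CatBuilt x₂ (blobTop l₂) (blobLaw l₂) := catBuilt_blobLaw x₂ hx₂0 hx₂1 l₂ hl₂
  have hPM : ∀ h, blobTop l₁ < h → blobLaw l₁ h = 0 := fun h hh => blobLaw_eq_zero l₁ h hh
  have hQM : ∀ h, blobTop l₂ < h → blobLaw l₂ h = 0 := fun h hh => blobLaw_eq_zero l₂ h hh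
  -- the nested gates
  have hγ0 : 0 < T - m₂ := by nlinarith [mul_pos hy0 hm₁]
  have hγ1 : (T - m₂) / m₁ ≤ 1 := by rw [div_le_one hm₁]; nlinarith [hm₂.le]
  have hγ'0 : 0 < T - m₁ := by nlinarith [mul_pos hy0 hm₂]
  have hγ'1 : (T - m₁) / m₂ ≤ 1 := by rw [div_le_one hm₂]; nlinarith [hm₁.le]
  -- column 1: gate_γ P ∗ Q, a caterpillar at floor y
  have hfl₁ : y ≤ (T - m₂) / m₁ * x₁ := by rw [div_mul_eq_mul_div, le_div_iff₀ hm₁]; linarith [hsl₁]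
  have c1 : CatBuilt y (blobTop l₁ + blobTop l₂) (lconv (blobTop l₁) (blobTop l₂) (gate (blobLaw l₁) ((T - m₂) / m₁)) (blobLaw l₂)) :=
    catBuilt_lconv_blobLaw ((cP.gate _ (div_pos hγ0 hm₁) hγ1).mono hy0 hfl₁) l₂ hly₂
  have hN₁ : InGatedCatHull y T (blobTop l₁ + blobTop l₂)
      (lconv (blobTop l₁) (blobTop l₂) (gate (blobLaw l₁) ((T - m₂) / m₁)) (blobLaw l₂)) := by
    have g := inGatedCatHull_of_catBuilt c1
    obtain ⟨_, gM, g1⟩ := gate_laws (blobTop l₁) (blobLaw l₁) ((T - m₂) / m₁) (div_pos hγ0 hm₁).le hγ1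
      (blobLaw_nonneg l₁ fun p hp => ⟨hx₁0.le.trans (hl₁ p hp).1, (hl₁ p hp).2⟩) hPM (sum_blobLaw l₁)
    rw [sum_mul_lconv _ _ _ _ g1 (sum_blobLaw l₂), sum_mul_gate, sum_mul_blobLaw, sum_mul_blobLaw] at g
    have e : (T - m₂) / m₁ * m₁ + m₂ = T := by field_simp; ring
    rwa [e] at g
  -- column 2: gate_γ′ Q ∗ P
  have hfl₂ : y ≤ (T - m₁) / m₂ * x₂ := by rw [div_mul_eq_mul_div, le_div_iff₀ hm₂]; linarith [hsl₂]
  have c2 : CatBuilt y (blobTop l₂ + blobTop l₁) (lconv (blobTop l₂) (blobTop l₁) (gate (blobLaw l₂) ((T - m₁) / m₂)) (blobLaw l₁)) :=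
    catBuilt_lconv_blobLaw ((cQ.gate _ (div_pos hγ'0 hm₂) hγ'1).mono hy0 hfl₂) l₁ hly₁
  have hN₂ : InGatedCatHull y T (blobTop l₁ + blobTop l₂)
      (lconv (blobTop l₂) (blobTop l₁) (gate (blobLaw l₂) ((T - m₁) / m₂)) (blobLaw l₁)) := by
    have g := inGatedCatHull_of_catBuilt c2
    obtain ⟨_, gM, g1⟩ := gate_laws (blobTop l₂) (blobLaw l₂) ((T - m₁) / m₂) (div_pos hγ'0 hm₂).le hγ'1
      (blobLaw_nonneg l₂ fun p hp => ⟨hx₂0.le.trans (hl₂ p hp).1, (hl₂ p hp).2⟩) hQM (sum_blobLaw l₂)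
    rw [sum_mul_lconv _ _ _ _ g1 (sum_blobLaw l₁), sum_mul_gate, sum_mul_blobLaw, sum_mul_blobLaw] at g
    have e : (T - m₁) / m₂ * m₂ + m₁ = T := by field_simp; ring
    rw [e, Nat.add_comm] at g
    exact g
  -- column 3: P ∗ Q at floor y(m₁+m₂)/T
  have hmm : 0 < m₁ + m₂ := by linarith
  have hw0 : 0 < y * (m₁ + m₂) / T := by positivity
  have hw₁ : y * (m₁ + m₂) / T ≤ x₁ := by rw [div_le_iff₀ hT0]; linarith [hf₁]
  have hw₂ : y * (m₁ + m₂) / T ≤ x₂ := by rw [div_le_iff₀ hT0]; linarith [hf₂]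
  have c3 : CatBuilt (y * (m₁ + m₂) / T) (blobTop l₁ + blobTop l₂) (lconv (blobTop l₁) (blobTop l₂) (blobLaw l₁) (blobLaw l₂)) :=
    catBuilt_lconv_blobLaw (cP.mono hw0 hw₁) l₂ fun p hp => ⟨hw₂.trans (hl₂ p hp).1, (hl₂ p hp).2⟩
  have hPQ : InGatedCatHull (y * (m₁ + m₂) / T) (m₁ + m₂) (blobTop l₁ + blobTop l₂)
      (lconv (blobTop l₁) (blobTop l₂) (blobLaw l₁) (blobLaw l₂)) := by
    have g := inGatedCatHull_of_catBuilt c3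
    rwa [sum_mul_lconv _ _ _ _ (sum_blobLaw l₁) (sum_blobLaw l₂), sum_mul_blobLaw, sum_mul_blobLaw] at g
  refine InGatedCatHull.lconv_gate_gate_of_large hN₁ hN₂ hPQ hPM hQM hy0 (div_nonneg (mul_nonneg hy0.le hmm.le) hT0.le) hm₁ hm₂ hs0.le
    hs1 ht0.le ht1 hT₁ le_rfl le_rfl ?_
  rw [div_mul_cancel₀ _ hT0.ne']

/-! ### The glued pair above `q = 1/2`, at every floor up to `(2q−1)s` -/

/-- **THE GLUED PAIR FOR EVERY ROOT GATE `q > 1/2`, AT EVERY FLOOR `y ≤ (2q−1)s`**: for `1/2 < q < 1`, `0 < s < 1`, every `c` and every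
`0 < y ≤ (2q−1)s`: `InGatedCatHull y (2q(1+cs)) (2c+2) (lpT c q s)` — the three columns `ρ ∗ gate_{2q−1}ρ` (twice, weight `q/2` each… summed `q`)
and `(1−q)·gate_q(ρ∗ρ)`, FREEHULL-G75 §4c's peel, valid once the floor is lowered by the deficit `(1−q)s`. [this work] -/
theorem lpT_inGatedCatHull_largeGate (c : ℕ) (q s y : ℝ) (hq : 1 / 2 < q) (hq1 : q < 1) (hs0 : 0 < s) (hs1 : s < 1) (hy0 : 0 < y)
    (hy : y ≤ (2 * q - 1) * s) : InGatedCatHull y (2 * q * (1 + c * s)) (2 * c + 2) (lpT c q s) := by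
  have hq0 : 0 < q := by linarith
  have hm : 0 < 1 + (c : ℝ) * s := by positivity
  have hys : y ≤ s := by nlinarith
  have hy1 : y < 1 := lt_of_le_of_lt hys hs1
  have hl : ∀ p ∈ [((c : ℕ), s), (1, (1 : ℝ))], s ≤ p.2 ∧ p.2 ≤ 1 := fun p hp => by
    simp only [List.mem_cons, List.not_mem_nil, or_false] at hp
    rcases hp with rfl | rfl
    · exact ⟨le_rfl, hs1.le⟩
    · exact ⟨hs1.le, le_rfl⟩
  have key := catPairBlob_inGatedCatHull_of_large [(c, s), (1, 1)] [(c, s), (1, 1)] hy0 hy1 hq0 hq1.le hq0 hq1 hys hs1 hys hs1 hl hl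
    (by rw [lpRho_blobMean]; exact hm) (by rw [lpRho_blobMean]; exact hm)
    (by rw [lpRho_blobMean]; nlinarith)
    (by rw [lpRho_blobMean]; nlinarith) (by rw [lpRho_blobMean]; nlinarith)
    (by rw [lpRho_blobMean]; nlinarith) (by rw [lpRho_blobMean]; nlinarith)
  rw [lpRho_blobMean, lpRho_blobTop, ← lpRho_eq_blobLaw] at key
  rw [show 2 * c + 2 = c + 1 + (c + 1) by omega, show 2 * q * (1 + c * s) = q * (1 + c * s) + q * (1 + c * s) by ring]
  exact key

/-- **SDEC of the glued pair at the floor `(2q−1)s`** for every `q ∈ (1/2, 1)` (no oracle). [this work] -/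
theorem sdec_lpT_largeGate (c : ℕ) (q s : ℝ) (hq : 1 / 2 < q) (hq1 : q < 1) (hs0 : 0 < s) (hs1 : s < 1) :
    SDEC ((2 * q - 1) * s) (2 * c + 2) (lpT c q s) :=
  sdec_of_inGatedCatHull (mul_pos (by linarith) hs0) (lpT_inGatedCatHull_largeGate c q s _ hq hq1 hs0 hs1 (mul_pos (by linarith) hs0) le_rfl)

/-- **THE NODE BELOW THE DEFICIT**: every tree-built presentation of the pair at a floor `x ≤ (2q−1)s` is in the hull at `x`, its own mean and
top — for ALL `q ∈ (1/2, 1)`, `c`, `s`. [this work] -/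
theorem treeBuiltCatHull_lpT_largeGate (c : ℕ) (q s : ℝ) (hq : 1 / 2 < q) (hq1 : q < 1) (hs0 : 0 < s) (hs1 : s < 1) (x : ℝ) (M : ℕ)
    (hTB : TreeBuilt x M (lpT c q s)) (hx : x ≤ (2 * q - 1) * s) :
    InGatedCatHull x (∑ h ∈ Finset.range (M + 1), (h : ℝ) * lpT c q s h) M (lpT c q s) := by
  obtain ⟨hx0, hM⟩ := lpT_treeBuilt_top c q s (by linarith) hq1.le hs0 hs1.le hTB
  obtain ⟨a, rfl⟩ := Nat.exists_eq_add_of_le hM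
  rw [sum_range_extend (fun h => (h : ℝ) * lpT c q s h) (2 * c + 2) a (fun h hh => by rw [lpT_eq_zero c q s h hh, mul_zero]),
    lpT_mean]
  exact (lpT_inGatedCatHull_largeGate c q s x hq hq1 hs0 hs1 hx0 hx).mono_top hM

/-! ### Unequal glued siblings in the large regime -/

/-- **UNEQUAL GLUED SIBLINGS, LARGE REGIME.**  `R¹[q](R^c[σ]) ∗ R¹[q′](R^{c′}[σ′])` with `m = 1 + cσ`, `m′ = 1 + c′σ′`, `T = q·m + q′·m′ ≥ m` (and the
slack inequalities below force `T > m′` too), `0 < q ≤ 1`, `0 < q′ < 1`, `0 < σ, σ′ < 1`: a member of `FH(y, T, (c+1)+(c′+1))` at every floor `0 < y`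
with `y ≤ σ`, `y ≤ σ′`, the SLACKS `y·m ≤ (T − m′)·σ`, `y·m′ ≤ (T − m)·σ′` and `y·(m+m′) ≤ σ·T`, `y·(m+m′) ≤ σ′·T`
(`catPairBlob_inGatedCatHull_of_large`).  The symmetric case is `lpT_inGatedCatHull_largeGate`. [this work] -/
theorem lpSib_pair_inGatedCatHull_of_large (c c' : ℕ) (q σ q' σ' y : ℝ) (hq0 : 0 < q) (hq1 : q ≤ 1) (hq'0 : 0 < q') (hq'1 : q' < 1)
    (hσ0 : 0 < σ) (hσ1 : σ < 1) (hσ'0 : 0 < σ') (hσ'1 : σ' < 1) (hy0 : 0 < y) (hyσ : y ≤ σ) (hyσ' : y ≤ σ')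
    (hT₁ : 1 + c * σ ≤ q * (1 + c * σ) + q' * (1 + c' * σ'))
    (hsl₁ : y * (1 + c * σ) ≤ (q * (1 + c * σ) + q' * (1 + c' * σ') - (1 + c' * σ')) * σ)
    (hsl₂ : y * (1 + c' * σ') ≤ (q * (1 + c * σ) + q' * (1 + c' * σ') - (1 + c * σ)) * σ')
    (hf₁ : y * ((1 + c * σ) + (1 + c' * σ')) ≤ σ * (q * (1 + c * σ) + q' * (1 + c' * σ')))
    (hf₂ : y * ((1 + c * σ) + (1 + c' * σ')) ≤ σ' * (q * (1 + c * σ) + q' * (1 + c' * σ'))) :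
    InGatedCatHull y (q * (1 + c * σ) + q' * (1 + c' * σ')) (c + 1 + (c' + 1))
      (lconv (c + 1) (c' + 1) (lpSib c q σ) (lpSib c' q' σ')) := by
  have hm : 0 < 1 + (c : ℝ) * σ := by positivity
  have hm' : 0 < 1 + (c' : ℝ) * σ' := by positivity
  have hy1 : y < 1 := lt_of_le_of_lt hyσ hσ1
  have hl₁ : ∀ p ∈ [((c : ℕ), σ), (1, (1 : ℝ))], σ ≤ p.2 ∧ p.2 ≤ 1 := fun p hp => by
    simp only [List.mem_cons, List.not_mem_nil, or_false] at hp
    rcases hp with rfl | rfl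
    · exact ⟨le_rfl, hσ1.le⟩
    · exact ⟨hσ1.le, le_rfl⟩
  have hl₂ : ∀ p ∈ [((c' : ℕ), σ'), (1, (1 : ℝ))], σ' ≤ p.2 ∧ p.2 ≤ 1 := fun p hp => by
    simp only [List.mem_cons, List.not_mem_nil, or_false] at hp
    rcases hp with rfl | rfl
    · exact ⟨le_rfl, hσ'1.le⟩
    · exact ⟨hσ'1.le, le_rfl⟩
  have key := catPairBlob_inGatedCatHull_of_large [(c, σ), (1, 1)] [(c', σ'), (1, 1)] hy0 hy1 hq0 hq1 hq'0 hq'1 hyσ hσ1 hyσ' hσ'1 hl₁ hl₂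
    (by rw [lpRho_blobMean]; exact hm) (by rw [lpRho_blobMean]; exact hm')
    (by rw [lpRho_blobMean, lpRho_blobMean]; exact hT₁)
    (by rw [lpRho_blobMean, lpRho_blobMean]; exact hsl₁) (by rw [lpRho_blobMean, lpRho_blobMean]; exact hsl₂)
    (by rw [lpRho_blobMean, lpRho_blobMean]; exact hf₁) (by rw [lpRho_blobMean, lpRho_blobMean]; exact hf₂)
  rw [lpRho_blobMean, lpRho_blobMean, lpRho_blobTop, lpRho_blobTop, ← lpRho_eq_blobLaw, ← lpRho_eq_blobLaw] at key
  exact key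

end LawDec
end Quant
end Summit.CriticalPhenomena.PercolationContinuityZ3.Theorems
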